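import Summits.Ventures.CertifiedManyBodySolver.Certificates.HubbardSquare_n1_obliqueStation_hf3_readers
import Summits.Ventures.CertifiedManyBodySolver.Certificates.HubbardSquare_U10_n1_tp3o10_lower_row681
import HarnessLib
import HarnessLib.Audit

/-!
# Ventures/CertifiedManyBodySolver — Certificates/HubbardSquare_n1_obliqueStation_hf3_discharge_r681.lean

HONEST FRAMING: BOOKKEEPING ONLY — the BY-VALUE hypothesis `h46v` of C-145 (hubbard-fast-reuse-2 g16, (N10) «n = 1 OBLIQUE STATION ON THE t′ = ±3/10
HALF-FILLING LOWERs -42, -44, -46», `Certificates/HubbardSquare_n1_stiffness_obliqueStation_hf3_*.lean`, readers `…_hf3_readers.lean`) IS, letter for letter,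
the landed claim node of CERTIFIED #681 (10, 1, +3/10) «M3 `GU10n1tp3o10`» (sr-mbsolver registry, APPENDED 2026-08-30T07:17:43Z; ref-3 g225 R3.460-46s; lit-4 module
`HubbardSquare_U10_n1_tp3o10_lower_row681.lean`, node `cert_r681_bs_GU10n1tp3o10_…_uprime : Prop :=
((−2772568073969535145395647/6044629098073145873530880 : ℚ) : ℝ) ≤ energyDensityTT' 1 (3/10) 10 1`) — so every C-145 word binding `h46v` is BY NAME on #681 from this
file on (the C-134 / #648 pattern, `HubbardSquare_n7o8_stiffness_splitPlaneStation_d2_discharge_r648.lean`). The `t′ = −3/10` copy follows by evenness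
(`n1_hf3_floor_U10_tpm3o10_of_v`). The -44 (8,1,+3/10) and -42 (6,1,+3/10) rows are not yet appended at write; their discharges follow in the same shape.
No word, no numeral, no new claim node, no definition, no `sorry`; not a registry row; no summit statement is proved by this seat.
-/

noncomputable section

namespace Summit.Ventures.CertifiedManyBodySolver.Certificates

open Literature.MathematicalPhysics.QuantumLattice
open Literature.MathematicalPhysics.QuantumLattice.ThermodynamicLimit

/-- `h46v` BY NAME: the claim node of CERTIFIED #681 is the inequality `−2772568073969535145395647/(5·2⁸⁰) ≤ e(1, 3/10, 10, 1)` itself. [cite: Griffiths1966, §II] -/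
theorem n1_hf3_h46v_of_node (h : cert_r681_bs_GU10n1tp3o10_w3_b4_R2_ob5p2_kry1_kry2c3rel_hanK7B4D4_KN4_PR20d4_hanK8c2s_uprime) :
    (((-2772568073969535145395647/6044629098073145873530880 : ℚ)) : ℝ) ≤ energyDensityTT' 1 (3/10) 10 1 := h

/-- The same row read at `t′ = −3/10` BY NAME (evenness at half filling, `n1_hf3_floor_U10_tpm3o10_of_v`). [cite: LiebWuPhysicaA2003, §1 eq. (3)] -/
theorem n1_hf3_floor_U10_tpm3o10_of_node (h : cert_r681_bs_GU10n1tp3o10_w3_b4_R2_ob5p2_kry1_kry2c3rel_hanK7B4D4_KN4_PR20d4_hanK8c2s_uprime) :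
    (((-2772568073969535145395647/6044629098073145873530880 : ℚ)) : ℝ) ≤ energyDensityTT' 1 (-3/10) 10 1 :=
  n1_hf3_floor_U10_tpm3o10_of_v (n1_hf3_h46v_of_node h)

end Summit.Ventures.CertifiedManyBodySolver.Certificates

end
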